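import Summits.CriticalPhenomena.CardyFormulaZ2.Theorems.CardyFlipRussoCoveringLegStubLowerInclusion
import HarnessLib

/-!
# Wide lower inclusion for the embedding bridge `stub_gsCardyOfUnionJack` (crux `Target`, line `Sketch` v8)

Helper file `--supports stmt-CriticalPhenomena-6431` (route `CardyFlipRusso`, sub-problem
`CriticalPhenomena/CardyFormulaZ2`, crux `Summit.CriticalPhenomena.CardyFormulaZ2.Theses.CardyFlipRusso.Target`,
registered stub `stub_gsCardyOfUnionJack` = the embedding bridge "Union-Jack crude Cardy ⟹ frame-A crude Cardy").
The bridge is the Bollobás–Riordan collar sandwich of `CardyFlipRussoCoveringLegRobust.lean` (crux `CoveringLeg`,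
p142502) run in the OPPOSITE direction; this file is its liminf half, the registered sub-goal
`gsBridge_lowerInclusionWide`.

THE STATEMENT.  `R = (Ω; arcs 0–3)` is a conformal rectangle and `Q` a comparison quad in lower sandwich position with
room `r`, lateral margin `m` and plate margin `t` (the clauses of `Sig.stub_comparisonGeometryStrong`: points of the
`r`-fattening `Q_r` of `Q` off `Ω` are `t`-close to `arc 0` or to `arc 2`, points of `Q_r` in `Ω` are `m`-far from
`arc 1` and `arc 3`, the `r`-fattened end arcs `Q.arc 0`, `Q.arc 2` lie off `Ω`, `t`-close to `arc 0`, resp. `arc 2`),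
and `arc 0`, `arc 2` are `3t`-separated.  Then for `0 < δ`, `4δ ≤ r`, `δ < m`, `δ ≤ t` and every translation
`‖a‖ ≤ δ`, the WIDE-slack crude frame-B crossing event `wideS Q δ` (slack `2√2·δ`, the Union-Jack event read at mesh
`√2·δ`) is contained in the standard crude crossing event `crossS (R + a) δ` of the TRANSLATED rectangle `R + a`
(slack `2δ`).  Compare the landed `stub_lowerInclusion` (p139913): there the quad is translated and the slacks are
`2δ ⊆ 2δ`; here the rectangle is translated and the slacks are `2√2·δ ⊆ 2δ`.

THE PROOF.  (1) `gsBridge_wideS_subset_crossS` — the unshifted inclusion `wideS Q δ ⊆ crossS R δ` under the sandwich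
clauses with room `r ≥ 3δ`: verbatim the proof of `stub_lowerInclusion` (Bollobás–Riordan 2006, Ch. 7 Claim 19 and
remark p. 195): the wide slack enters only through "the endpoints lie in the `r`-fattened end arcs of `Q`"
(`2√2·δ ≤ 3δ ≤ r`), after which the open path starts off `Ω` on side 0 and ends off `Ω` on side 2; after its LAST
side-0 site it enters `Ω` at a site within one mesh edge `≤ δ ≤ 2δ` of `arc 0` (`lower_entry`), and it first leaves `Ω`
across `arc 2` from a site within `δ` of `arc 2`; the piece in between is an open path of `crossS R δ`.
(2) `gsBridge_sandwich_translate` — the sandwich clauses for `(R, Q)` with room `r` give the clauses for `(R + a, Q)`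
with room `r − δ` (`‖a‖ ≤ δ`): translate the test point back by `a` (`Metric.infDist_image` for the isometry
`p ↦ p + a`, `cthickening δ (cthickening (r − δ) ·) ⊆ cthickening r ·`).  (3) Combine with `4δ ≤ r`.

References: B. Bollobás, O. Riordan, *Percolation*, CUP (2006), Ch. 7 Claim 19 p. 192 and remark p. 195
[BollobasRiordan2006]; V. Beffara, *Is critical 2D percolation universal?*, Progr. Probab. 60 (2008) §5.1
[Beffara2008Universal].
(buildfix 2026-08-20: comment-only re-land to re-enqueue the module build after its blocking imports were repaired; no declaration changed.)
-/

noncomputable section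

namespace Summit.CriticalPhenomena.CardyFormulaZ2.Theorems.CardyFlipRussoTarget

open Set Metric
open Literature.Probability.RandomPlanarGeometry Literature.Probability.Percolation
open Literature.Barriers.CriticalPhenomena (MixedSite)
open Summit.CriticalPhenomena.CardyFormulaZ2.Cruxes.CoveringLeg.FiveArmNull

/-! ### Metric bookkeeping -/

/-- A point within `s ≤ r` of a boundary arc lies in the `r`-fattening of the arc (nearest point of the compact arc).
[folklore] -/
theorem gsBridge_mem_cthickening_arc (Q : ConformalRectangle) (i : Fin 4) {p : ℂ} {s r : ℝ}
    (h : infDist p (Q.arc i) ≤ s) (hsr : s ≤ r) : p ∈ cthickening r (Q.arc i) := by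
  obtain ⟨q, hq, hpq⟩ := (Q.isCompact_arc i).exists_infDist_eq_dist ⟨_, Q.pt_mem_arc_self i⟩ p
  exact mem_cthickening_of_dist_le p q r _ hq (by rw [← hpq]; exact h.trans hsr)

/-- **Translating a rectangle**: membership in the carrier and distances to the arcs of `R + a` are those of the
back-translated point for `R` (`p ↦ p + a` is an isometry). [folklore] -/
theorem gsBridge_translate_facts (R : ConformalRectangle) (a z : ℂ) :
    (z ∈ (R.map (similarity 1 one_ne_zero a)).carrier ↔ z - a ∈ R.carrier) ∧
      ∀ i : Fin 4, infDist z ((R.map (similarity 1 one_ne_zero a)).arc i) = infDist (z - a) (R.arc i) := by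
  have hΦ : ((similarity 1 one_ne_zero a : ℂ ≃ₜ ℂ) : ℂ → ℂ) = fun p => p + a :=
    funext fun p => by rw [similarity_apply, one_mul]
  have hiso : Isometry (fun p : ℂ => p + a) := isometry_add_right a
  have hz : (fun p : ℂ => p + a) (z - a) = z := sub_add_cancel z a
  constructor
  · rw [MarkedDomain.carrier_map, hΦ]
    constructor
    · rintro ⟨w, hw, hwz⟩
      have hw' : w = z - a := by rw [← hwz]; exact (add_sub_cancel_right w a).symm
      rwa [← hw']
    · exact fun h => ⟨z - a, h, sub_add_cancel z a⟩
  · intro i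
    rw [MarkedDomain.arc_map, hΦ]
    conv_lhs => rw [← hz]
    exact infDist_image hiso

/-- A point of the `(r − δ)`-fattening of `A`, translated back by `‖a‖ ≤ δ ≤ r`, lies in the `r`-fattening of `A`.
[folklore] -/
theorem gsBridge_sub_mem_cthickening {A : Set ℂ} {a z : ℂ} {δ r : ℝ} (ha : ‖a‖ ≤ δ) (hδ : 0 ≤ δ) (hδr : δ ≤ r)
    (hz : z ∈ cthickening (r - δ) A) : z - a ∈ cthickening r A := by
  have h1 : z - a ∈ cthickening δ (cthickening (r - δ) A) :=
    mem_cthickening_of_dist_le (z - a) z δ _ hz (by rw [dist_eq_norm, sub_sub_cancel_left, norm_neg]; exact ha)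
  have h2 := cthickening_cthickening_subset hδ (by linarith : 0 ≤ r - δ) A h1
  rwa [add_sub_cancel] at h2

/-- **The sandwich clauses are translation-covariant up to one mesh of room**: if the lower quad `Q` of `R` is in
sandwich position with room `r`, margins `m, t`, then `Q` is in sandwich position for the translated rectangle `R + a`,
`‖a‖ ≤ δ ≤ r`, with room `r − δ` and the same margins; the `3t`-separation of the end arcs is translation invariant.
[folklore] -/
theorem gsBridge_sandwich_translate (R Q : ConformalRectangle) {m t r δ : ℝ} {a : ℂ} (ha : ‖a‖ ≤ δ)
    (hδ : 0 ≤ δ) (hδr : δ ≤ r)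
    (h3 : ∀ z ∈ cthickening r Q.carrier, z ∉ R.carrier → infDist z (R.arc 0) ≤ t ∨ infDist z (R.arc 2) ≤ t)
    (h4 : ∀ z ∈ cthickening r Q.carrier, z ∈ R.carrier → m ≤ infDist z (R.arc 1) ∧ m ≤ infDist z (R.arc 3))
    (h5 : ∀ z ∈ cthickening r (Q.arc 0), z ∉ R.carrier ∧ infDist z (R.arc 0) ≤ t)
    (h6 : ∀ z ∈ cthickening r (Q.arc 2), z ∉ R.carrier ∧ infDist z (R.arc 2) ≤ t)
    (hsep : ∀ x ∈ R.arc 0, ∀ y ∈ R.arc 2, 3 * t < dist x y) :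
    (∀ z ∈ cthickening (r - δ) Q.carrier, z ∉ (R.map (similarity 1 one_ne_zero a)).carrier →
        infDist z ((R.map (similarity 1 one_ne_zero a)).arc 0) ≤ t ∨
          infDist z ((R.map (similarity 1 one_ne_zero a)).arc 2) ≤ t) ∧
    (∀ z ∈ cthickening (r - δ) Q.carrier, z ∈ (R.map (similarity 1 one_ne_zero a)).carrier →
        m ≤ infDist z ((R.map (similarity 1 one_ne_zero a)).arc 1) ∧
          m ≤ infDist z ((R.map (similarity 1 one_ne_zero a)).arc 3)) ∧
    (∀ z ∈ cthickening (r - δ) (Q.arc 0), z ∉ (R.map (similarity 1 one_ne_zero a)).carrier ∧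
        infDist z ((R.map (similarity 1 one_ne_zero a)).arc 0) ≤ t) ∧
    (∀ z ∈ cthickening (r - δ) (Q.arc 2), z ∉ (R.map (similarity 1 one_ne_zero a)).carrier ∧
        infDist z ((R.map (similarity 1 one_ne_zero a)).arc 2) ≤ t) ∧
    (∀ x ∈ (R.map (similarity 1 one_ne_zero a)).arc 0, ∀ y ∈ (R.map (similarity 1 one_ne_zero a)).arc 2,
        3 * t < dist x y) := by
  have hT := gsBridge_translate_facts R a
  refine ⟨fun z hz hzR => ?_, fun z hz hzR => ?_, fun z hz => ?_, fun z hz => ?_, fun x hx y hy => ?_⟩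
  · rw [(hT z).1] at hzR
    rw [(hT z).2 0, (hT z).2 2]
    exact h3 _ (gsBridge_sub_mem_cthickening ha hδ hδr hz) hzR
  · rw [(hT z).1] at hzR
    rw [(hT z).2 1, (hT z).2 3]
    exact h4 _ (gsBridge_sub_mem_cthickening ha hδ hδr hz) hzR
  · rw [(hT z).1, (hT z).2 0]
    exact h5 _ (gsBridge_sub_mem_cthickening ha hδ hδr hz)
  · rw [(hT z).1, (hT z).2 2]
    exact h6 _ (gsBridge_sub_mem_cthickening ha hδ hδr hz)
  · rw [MarkedDomain.arc_map] at hx hy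
    obtain ⟨x₀, hx₀, rfl⟩ := hx
    obtain ⟨y₀, hy₀, rfl⟩ := hy
    rw [similarity_apply, similarity_apply, one_mul, one_mul, dist_add_right]
    exact hsep x₀ hx₀ y₀ hy₀

/-! ### The wide lower inclusion, unshifted -/

/-- **Wide lower inclusion (unshifted).**  If the lower quad `Q` of `R` is in sandwich position with room `r`, margins
`m, t`, the end arcs of `R` are `3t`-separated and `0 < δ`, `3δ ≤ r`, `δ < m`, `δ ≤ t`, then the wide-slack crude
frame-B crossing event of `Q` at mesh `δ` is contained in the standard crude crossing event of `R` (the proof of the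
landed `stub_lowerInclusion`, verbatim up to the endpoint clause `2√2·δ ≤ 3δ ≤ r`).
[cite: BollobasRiordan2006, Ch. 7 Claim 19 p. 192 and remark p. 195] -/
theorem gsBridge_wideS_subset_crossS (R Q : ConformalRectangle) {m t r : ℝ}
    (h3 : ∀ z ∈ cthickening r Q.carrier, z ∉ R.carrier → infDist z (R.arc 0) ≤ t ∨ infDist z (R.arc 2) ≤ t)
    (h4 : ∀ z ∈ cthickening r Q.carrier, z ∈ R.carrier → m ≤ infDist z (R.arc 1) ∧ m ≤ infDist z (R.arc 3))
    (h5 : ∀ z ∈ cthickening r (Q.arc 0), z ∉ R.carrier ∧ infDist z (R.arc 0) ≤ t)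
    (h6 : ∀ z ∈ cthickening r (Q.arc 2), z ∉ R.carrier ∧ infDist z (R.arc 2) ≤ t)
    (hsep : ∀ x ∈ R.arc 0, ∀ y ∈ R.arc 2, 3 * t < dist x y)
    {δ : ℝ} (hδ : 0 < δ) (hδr : 3 * δ ≤ r) (hδm : δ < m) (hδt : δ ≤ t) :
    wideS Q δ ⊆ crossS R δ := by
  rintro ω ⟨u, v, hu, hv, hω⟩
  -- geometry of `R`
  have hfr := frontier_subset_arcs_zero_two R
  have hfr' : frontier R.carrier ⊆ (R.arc 2 ∪ R.arc 0) ∪ (R.arc 1 ∪ R.arc 3) := by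
    rwa [union_comm (R.arc 2)]
  have hsep' : ∀ x ∈ R.arc 2, ∀ y ∈ R.arc 0, 3 * t < dist x y := fun x hx y hy => by
    rw [dist_comm]; exact hsep y hy x hx
  have hc0 := R.isCompact_arc 0
  have hc2 := R.isCompact_arc 2
  have hn0 : (R.arc 0).Nonempty := ⟨_, R.pt_mem_arc_self 0⟩
  have hn2 : (R.arc 2).Nonempty := ⟨_, R.pt_mem_arc_self 2⟩
  have hsl : 2 * Real.sqrt 2 * δ ≤ r := (wide_slack_le_three hδ.le).trans hδr
  -- (F1) sites of the window of `Q` are drawn in the `r`-fattening of `Q`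
  have hthick : ∀ y : MixedSite, (δ : ℂ) * zS y ∈ Q.carrier → (δ : ℂ) * zS y ∈ cthickening r Q.carrier :=
    fun y hy => self_subset_cthickening _ hy
  -- (F3) the endpoints: `u` is off `Ω` on side 0, `v` is off `Ω` on side 2 (here the wide slack is spent)
  obtain ⟨huΩ, hu0⟩ := h5 _ (gsBridge_mem_cthickening_arc Q 0 hu hsl)
  obtain ⟨hvΩ, hv2⟩ := h6 _ (gsBridge_mem_cthickening_arc Q 2 hv hsl)
  -- (F5) the open path and its last side-0 site
  have hp : PathIn gsGraph ({y | (δ : ℂ) * zS y ∈ Q.carrier} ∩ ω) u v := PathIn.of_mem_siteConnIn hω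
  have hvC : v ∉ {y : MixedSite | (δ : ℂ) * zS y ∉ R.carrier ∧
      infDist ((δ : ℂ) * zS y) (R.arc 0) ≤ t} := fun h =>
    lower_sep hc0 hc2 hn0 hn2 hsep hδt (by rw [dist_self]; exact hδ.le) h.2 hv2
  obtain ⟨a₀, b, ha₀C, -, hbC, hab, hpb⟩ :=
    hp.last_exit (C := {y : MixedSite | (δ : ℂ) * zS y ∉ R.carrier ∧
      infDist ((δ : ℂ) * zS y) (R.arc 0) ≤ t}) ⟨huΩ, hu0⟩ hvC
  have hbA := hpb.left_mem
  have hdab : dist ((δ : ℂ) * zS a₀) ((δ : ℂ) * zS b) ≤ δ := lower_dist_le hδ hab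
  -- the site `b` after the last side-0 site is inside `Ω` …
  have hbΩ : (δ : ℂ) * zS b ∈ R.carrier := by
    by_contra hbΩ
    rcases h3 _ (hthick b hbA.1.1) hbΩ with h0 | h2
    · exact hbC ⟨hbΩ, h0⟩
    · exact lower_sep hc0 hc2 hn0 hn2 hsep hδt hdab ha₀C.2 h2
  -- … and within `δ` of `arc 0`
  obtain ⟨hb1, hb3⟩ := h4 _ (hthick b hbA.1.1) hbΩ
  have hb0 : infDist ((δ : ℂ) * zS b) (R.arc 0) ≤ δ :=
    lower_entry R.isOpen hfr hc0 hc2 hn0 hn2 hsep hδt hδm hdab ha₀C.1 ha₀C.2 hbΩ hb1 hb3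
  -- the first exit from `Ω` after `b`: across `arc 2`
  obtain ⟨a', b', ha'R, hb'R, hb'A, hab', hpa'⟩ :=
    hpb.exit (R := {y : MixedSite | (δ : ℂ) * zS y ∈ R.carrier}) hbΩ hvΩ
  have hda'b' : dist ((δ : ℂ) * zS b') ((δ : ℂ) * zS a') ≤ δ := by
    rw [dist_comm]; exact lower_dist_le hδ hab'
  have hb'2 : infDist ((δ : ℂ) * zS b') (R.arc 2) ≤ t := by
    rcases h3 _ (hthick b' hb'A.1.1) hb'R with h0 | h2
    · exact absurd ⟨hb'R, h0⟩ hb'A.2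
    · exact h2
  have ha'A := hpa'.right_mem
  obtain ⟨ha'1, ha'3⟩ := h4 _ (hthick a' ha'A.2.1.1) ha'R
  have ha'2 : infDist ((δ : ℂ) * zS a') (R.arc 2) ≤ δ :=
    lower_entry R.isOpen hfr' hc2 hc0 hn2 hn0 hsep' hδt hδm hda'b' hb'R hb'2 ha'R ha'1 ha'3
  -- the piece from `b` to `a'` is an open crude crossing of `R`
  refine ⟨b, a', hb0.trans (by linarith), ha'2.trans (by linarith), ?_⟩
  exact (hpa'.mono (A' := {y : MixedSite | (δ : ℂ) * zS y ∈ R.carrier} ∩ ω)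
    fun y hy => ⟨hy.1, hy.2.1.2⟩).mem_siteConnIn

/-! ### The registered sub-goal: the wide lower inclusion for the translated rectangle -/

/-- **Registered sub-goal `gsBridge_lowerInclusionWide`** (liminf half of the embedding bridge `stub_gsCardyOfUnionJack`):
if the lower quad `Q` of `R` is in sandwich position with room `r`, margins `m, t`, the end arcs of `R` are
`3t`-separated, and `0 < δ`, `4δ ≤ r`, `δ < m`, `δ ≤ t`, then for every translation `‖a‖ ≤ δ` the wide-slack crude
frame-B crossing event `wideS Q δ` is contained in the crude crossing event `crossS (R + a) δ` of the translated
rectangle (translate the clauses, `gsBridge_sandwich_translate`, then `gsBridge_wideS_subset_crossS` with room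
`r − δ ≥ 3δ`). [cite: BollobasRiordan2006, Ch. 7 Claim 19 p. 192 and remark p. 195] -/
theorem gsBridge_lowerInclusionWide : ∀ (R Q : Literature.Probability.RandomPlanarGeometry.ConformalRectangle) (m t r : ℝ), 0 < m → 0 < t → 0 < r → (∀ z ∈ Metric.cthickening r Q.carrier, z ∉ R.carrier → Metric.infDist z (R.arc 0) ≤ t ∨ Metric.infDist z (R.arc 2) ≤ t) → (∀ z ∈ Metric.cthickening r Q.carrier, z ∈ R.carrier → m ≤ Metric.infDist z (R.arc 1) ∧ m ≤ Metric.infDist z (R.arc 3)) → (∀ z ∈ Metric.cthickening r (Q.arc 0), z ∉ R.carrier ∧ Metric.infDist z (R.arc 0) ≤ t) → (∀ z ∈ Metric.cthickening r (Q.arc 2), z ∉ R.carrier ∧ Metric.infDist z (R.arc 2) ≤ t) → (∀ x ∈ R.arc 0, ∀ y ∈ R.arc 2, 3 * t < dist x y) → ∀ δ : ℝ, 0 < δ → 4 * δ ≤ r → δ < m → δ ≤ t → ∀ a : ℂ, ‖a‖ ≤ δ → Summit.CriticalPhenomena.CardyFormulaZ2.Cruxes.CoveringLeg.FiveArmNull.wideS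 Q δ ⊆ Summit.CriticalPhenomena.CardyFormulaZ2.Cruxes.CoveringLeg.FiveArmNull.crossS (R.map (Literature.Probability.RandomPlanarGeometry.similarity 1 one_ne_zero a)) δ := by
  intro R Q m t r _hm _ht _hr h3 h4 h5 h6 hsep δ hδ hδr hδm hδt a ha
  have hδr' : δ ≤ r := by linarith
  obtain ⟨h3', h4', h5', h6', hsep'⟩ := gsBridge_sandwich_translate R Q ha hδ.le hδr' h3 h4 h5 h6 hsep
  exact gsBridge_wideS_subset_crossS (R.map (similarity 1 one_ne_zero a)) Q h3' h4' h5' h6' hsep' hδ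
    (by linarith) hδm hδt

end Summit.CriticalPhenomena.CardyFormulaZ2.Theorems.CardyFlipRussoTarget

end
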